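import Literature.MathematicalPhysics.KineticTheory.HardSphereEulerProofs
import Mathlib.Probability.Moments.Basic
import Mathlib.Analysis.Convex.Integral
import Mathlib.Analysis.Convex.SpecificFunctions.Basic

/-!
# Tilted activities: exponential concentration of the density field of the canonical hard-sphere gas from the tilted mean densities

Helper file for item `LocalGibbsConcentrationDilute` (stmt-AtomisticToContinuum-13460) of route
`JaynesSqueeze`. For the configurational canonical Gibbs measure `μ_a = posGibbsMeasure a ε n`
(`Z(a)⁻¹ 𝟙_{no overlap} ∏ a(xᵢ) dx`) and the additive observable `S(x) = ∑ᵢ χ(xᵢ)`: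

* `posWeight_tilt`: tilting the activity by `e^{tχ}` multiplies the weight by `e^{tS}`;
* `integral_posGibbsMeasure`: `∫ F dμ_a = Z(a)⁻¹ ∫ 𝟙 ∏a · F`;
* `posGibbsMeasure_sum_ge_le_exp` (**the tilt bound**): for `t ≥ 0`,
  `μ_a {s ≤ S} ≤ exp(t (m_t - s))`, where `m_t = ∫ S dμ_{a e^{tχ}}` is the mean of `S` under the
  TILTED activity. Proof: Markov's inequality `μ_a{s ≤ S} ≤ e^{-ts} E_a e^{tS}`, the partition
  function identity `E_a e^{tS} = Z(ae^{tχ})/Z(a) = (E_{ae^{tχ}} e^{-tS})⁻¹` and Jensen's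
  inequality `E_{ae^{tχ}} e^{-tS} ≥ e^{-t m_t}`. No asymptotics of `log Z` is needed: the
  large-deviation upper bound is reduced to the law of large numbers for the MEAN density under
  tilted activities;
* `posGibbsMeasure_density_concentration`: if for some `t > 0` the tilted mean densities
  `(N+1)⁻¹ m_{±t}` are eventually within `δ/2` of `I`, the density field `(N+1)⁻¹ S` deviates from
  `I` by more than `δ` with probability `≤ C e^{-(N+1)/C}` for all `N`.

No definitions (pure-proof helper file). prover-pitem-stmt-AtomisticToContinuum-13460-0.
-/

noncomputable section

namespace Summit.AtomisticToContinuum.HydrodynamicLimit.Theorems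

open MeasureTheory ProbabilityTheory Filter Topology Set
open Literature.Analysis.FluidPDE Literature.MathematicalPhysics.KineticTheory
open scoped ENNReal

namespace LocalGibbsConcentration

section Generic

/-- **From an eventual exponential bound to a global one.** If `p N ≤ 1` for all `N` and
`p N ≤ A e^{-κ (N+1)}` for `N ≥ N₀` (`κ > 0`), then `p N ≤ C e^{-(N+1)/C}` for all `N`, for some
`C > 0`. [folklore] -/
theorem exists_const_exp_bound {p : ℕ → ℝ≥0∞} (hp1 : ∀ N, p N ≤ 1) {A κ : ℝ} (hκ : 0 < κ)
    {N₀ : ℕ} (hp : ∀ N, N₀ ≤ N → p N ≤ ENNReal.ofReal (A * Real.exp (-κ * (N + 1)))) :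
    ∃ C : ℝ, 0 < C ∧ ∀ N : ℕ, p N ≤ ENNReal.ofReal (C * Real.exp (-(C⁻¹ * (N + 1)))) := by
  set C : ℝ := max (max 3 (N₀ + 1)) (max A 0 + κ⁻¹) with hC
  have hC3 : 3 ≤ C := (le_max_left _ _).trans (le_max_left _ _)
  have hCpos : 0 < C := by linarith
  have hCN : (N₀ : ℝ) + 1 ≤ C := (le_max_right _ _).trans (le_max_left _ _)
  have hCA : max A 0 ≤ C := by
    have : max A 0 + κ⁻¹ ≤ C := le_max_right _ _
    linarith [inv_pos.2 hκ]
  have hCκ : C⁻¹ ≤ κ := by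
    have h1 : κ⁻¹ ≤ C := by
      have : max A 0 + κ⁻¹ ≤ C := le_max_right _ _
      linarith [le_max_right A 0]
    rw [inv_le_comm₀ hCpos hκ]
    exact h1
  refine ⟨C, hCpos, fun N => ?_⟩
  by_cases hN : N₀ ≤ N
  · refine (hp N hN).trans (ENNReal.ofReal_le_ofReal ?_)
    have hN1 : (0 : ℝ) ≤ N + 1 := by positivity
    calc A * Real.exp (-κ * (N + 1)) ≤ max A 0 * Real.exp (-κ * (N + 1)) :=
          mul_le_mul_of_nonneg_right (le_max_left _ _) (Real.exp_pos _).le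
      _ ≤ C * Real.exp (-(C⁻¹ * (N + 1))) := by
          refine mul_le_mul hCA (Real.exp_le_exp.2 ?_) (Real.exp_pos _).le hCpos.le
          nlinarith
  · push Not at hN
    refine (hp1 N).trans ?_
    rw [← ENNReal.ofReal_one]
    refine ENNReal.ofReal_le_ofReal ?_
    -- `(N+1)/C ≤ 1`, so `C e^{-(N+1)/C} ≥ 3/e ≥ 1`
    have hle : C⁻¹ * (N + 1) ≤ 1 := by
      rw [inv_mul_le_iff₀ hCpos, mul_one]
      have : (N : ℝ) + 1 ≤ N₀ := by exact_mod_cast hN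
      linarith
    have hexp : Real.exp (-1) ≤ Real.exp (-(C⁻¹ * (N + 1))) := Real.exp_le_exp.2 (by linarith)
    have he : (1 : ℝ) ≤ 3 * Real.exp (-1) := by
      rw [Real.exp_neg]
      have := Real.exp_one_lt_d9
      rw [le_mul_inv_iff₀ (Real.exp_pos 1)]
      linarith
    calc (1 : ℝ) ≤ 3 * Real.exp (-1) := he
      _ ≤ C * Real.exp (-(C⁻¹ * (N + 1))) :=
          mul_le_mul hC3 hexp (Real.exp_pos _).le hCpos.le

end Generic

section PosGibbs

variable {a : T3 → ℝ}

/-- The tilted activity `a e^{tχ}` is continuous. [folklore] -/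
theorem continuous_tilt (ha : Continuous a) {χ : T3 → ℝ} (hχ : Continuous χ) (t : ℝ) :
    Continuous fun y => a y * Real.exp (t * χ y) := by fun_prop

/-- The tilted activity `a e^{tχ}` is positive. [folklore] -/
theorem tilt_pos (ha0 : ∀ y, 0 < a y) (χ : T3 → ℝ) (t : ℝ) (y : T3) :
    0 < a y * Real.exp (t * χ y) := mul_pos (ha0 y) (Real.exp_pos _)

/-- **Tilting the activity multiplies the position weight by `e^{t ∑ χ(xᵢ)}`.** [folklore] -/
theorem posWeight_tilt (χ : T3 → ℝ) (t ε : ℝ) (n : ℕ) (x : Fin n → T3) :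
    posWeight (fun y => a y * Real.exp (t * χ y)) ε n x =
      posWeight a ε n x * Real.exp (t * ∑ i, χ (x i)) := by
  unfold posWeight
  rw [← Set.indicator_mul_left (f := fun x : Fin n → T3 => ∏ i, a (x i))
    (g := fun x => Real.exp (t * ∑ i, χ (x i)))]
  congr 1
  funext x
  rw [Finset.prod_mul_distrib, Finset.mul_sum, Real.exp_sum]

/-- Integration against the configurational Gibbs measure:
`∫ F dμ_a = Z(a)⁻¹ ∫ 𝟙_{no overlap} ∏ a(xᵢ) F(x) dx`. [folklore] -/
theorem integral_posGibbsMeasure (ha : Continuous a) (ha0 : ∀ y, 0 ≤ a y) (ε : ℝ) (n : ℕ)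
    (F : (Fin n → T3) → ℝ) :
    ∫ x, F x ∂posGibbsMeasure a ε n = (posPartition a ε n)⁻¹ * ∫ x, posWeight a ε n x * F x := by
  have hm : Measurable fun x : Fin n → T3 =>
      ENNReal.ofReal ((posPartition a ε n)⁻¹ * posWeight a ε n x) :=
    (measurable_const.mul (measurable_posWeight ha ε n)).ennreal_ofReal
  rw [posGibbsMeasure, integral_withDensity_eq_integral_toReal_smul hm
    (Eventually.of_forall fun _ => ENNReal.ofReal_lt_top), ← integral_const_mul]
  refine integral_congr_ae (Eventually.of_forall fun x => ?_)
  simp only [smul_eq_mul]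
  rw [ENNReal.toReal_ofReal (mul_nonneg (inv_nonneg.2 (posPartition_nonneg ha0 ε n))
    (posWeight_nonneg ha0 ε x)), mul_assoc]

/-- A bounded measurable function times the position weight is integrable. [folklore] -/
theorem integrable_posWeight_mul (ha : Continuous a) (ha0 : ∀ y, 0 ≤ a y) (ε : ℝ) (n : ℕ)
    {F : (Fin n → T3) → ℝ} (hF : Measurable F) {K : ℝ} (hK : ∀ x, |F x| ≤ K) :
    Integrable (fun x => posWeight a ε n x * F x) := by
  refine (integrable_posWeight ha ha0 ε n).mul_bdd (c := K) hF.aestronglyMeasurable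
    (Eventually.of_forall fun x => ?_)
  rw [Real.norm_eq_abs]
  exact hK x

variable {χ : T3 → ℝ}

/-- The additive observable `S(x) = ∑ᵢ χ(xᵢ)` is bounded by `n sup|χ|`. [folklore] -/
theorem abs_sum_le {K : ℝ} (hK : ∀ y, |χ y| ≤ K) {n : ℕ} (x : Fin n → T3) :
    |∑ i, χ (x i)| ≤ n * K :=
  calc |∑ i, χ (x i)| ≤ ∑ i, |χ (x i)| := Finset.abs_sum_le_sum_abs _ _
    _ ≤ ∑ _i : Fin n, K := Finset.sum_le_sum fun i _ => hK (x i)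
    _ = n * K := by simp

/-- `S(x) = ∑ᵢ χ(xᵢ)` is measurable for continuous `χ`. [folklore] -/
theorem measurable_sum (hχ : Continuous χ) (n : ℕ) :
    Measurable fun x : Fin n → T3 => ∑ i, χ (x i) :=
  Finset.measurable_sum _ fun i _ => hχ.measurable.comp (measurable_pi_apply i)

/-- **Partition functions under tilting**: `Z(a e^{tχ}) = ∫ 𝟙 ∏a · e^{tS}`, i.e.
`E_{μ_a} e^{tS} = Z(ae^{tχ})/Z(a)`. [folklore] -/
theorem integral_exp_mul_sum_posGibbsMeasure (ha : Continuous a) (ha0 : ∀ y, 0 ≤ a y)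
    (χ : T3 → ℝ) (t ε : ℝ) (n : ℕ) :
    ∫ x, Real.exp (t * ∑ i, χ (x i)) ∂posGibbsMeasure a ε n =
      (posPartition a ε n)⁻¹ * posPartition (fun y => a y * Real.exp (t * χ y)) ε n := by
  rw [integral_posGibbsMeasure ha ha0, posPartition]
  congr 1
  refine integral_congr_ae (Eventually.of_forall fun x => ?_)
  exact (posWeight_tilt χ t ε n x).symm

/-- **The inverse ratio as a tilted expectation**: `E_{μ_{ae^{tχ}}} e^{-tS} = Z(a)/Z(ae^{tχ})`.
[folklore] -/
theorem integral_exp_neg_mul_sum_posGibbsMeasure_tilt (ha : Continuous a) (ha0 : ∀ y, 0 ≤ a y)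
    (hχ : Continuous χ) (t ε : ℝ) (n : ℕ) :
    ∫ x, Real.exp (-(t * ∑ i, χ (x i))) ∂posGibbsMeasure (fun y => a y * Real.exp (t * χ y)) ε n =
      (posPartition (fun y => a y * Real.exp (t * χ y)) ε n)⁻¹ * posPartition a ε n := by
  have ha0' : ∀ y, 0 ≤ a y * Real.exp (t * χ y) := fun y => mul_nonneg (ha0 y) (Real.exp_pos _).le
  rw [integral_posGibbsMeasure (continuous_tilt ha hχ t) ha0', posPartition]
  congr 1
  refine integral_congr_ae (Eventually.of_forall fun x => ?_)
  show posWeight (fun y => a y * Real.exp (t * χ y)) ε n x * Real.exp (-(t * ∑ i, χ (x i))) =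
    posWeight a ε n x
  rw [posWeight_tilt (a := a) χ t ε n x, mul_assoc, ← Real.exp_add, add_neg_cancel, Real.exp_zero,
    mul_one]

/-- **The tilt bound.** For continuous `a > 0`, continuous `χ`, `σ ≤ 1/2` (so that all partition
functions are positive) and `t ≥ 0`: the configurational Gibbs probability that
`S = ∑ᵢ χ(xᵢ) ≥ s` is at most `exp(t (m_t - s))`, where `m_t = ∫ S dμ_{ae^{tχ}}` is the mean of `S`
under the tilted activity (Markov + `E_a e^{tS} = Z(ae^{tχ})/Z(a)` + Jensen under the tilted
measure). [folklore] -/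
theorem posGibbsMeasure_sum_ge_le_exp (ha : Continuous a) (ha0 : ∀ y, 0 < a y)
    (hχ : Continuous χ) {σ : ℝ} (hσ2 : σ ≤ 1 / 2) (N : ℕ) {t : ℝ} (ht : 0 ≤ t) (s : ℝ) :
    posGibbsMeasure a (hsDiameter σ N) (N + 1) {x | s ≤ ∑ i, χ (x i)} ≤
      ENNReal.ofReal (Real.exp (t * ((∫ x, ∑ i, χ (x i)
        ∂posGibbsMeasure (fun y => a y * Real.exp (t * χ y)) (hsDiameter σ N) (N + 1)) - s))) := by
  set ε := hsDiameter σ N with hε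
  set n := N + 1 with hn
  set at_ : T3 → ℝ := fun y => a y * Real.exp (t * χ y) with hat
  have ha0' : ∀ y, 0 ≤ a y := fun y => (ha0 y).le
  have hat_cont : Continuous at_ := continuous_tilt ha hχ t
  have hat_pos : ∀ y, 0 < at_ y := tilt_pos ha0 χ t
  haveI hμ : IsProbabilityMeasure (posGibbsMeasure a ε n) :=
    isProbabilityMeasure_posGibbsMeasure ha ha0 hσ2 N
  haveI hμt : IsProbabilityMeasure (posGibbsMeasure at_ ε n) :=
    isProbabilityMeasure_posGibbsMeasure hat_cont hat_pos hσ2 N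
  have hZ : 0 < posPartition a ε n := posPartition_pos ha ha0 hσ2 N
  have hZt : 0 < posPartition at_ ε n := posPartition_pos hat_cont hat_pos hσ2 N
  obtain ⟨K, -, hK⟩ := exists_forall_abs_le_of_continuous hχ
  set S : (Fin n → T3) → ℝ := fun x => ∑ i, χ (x i) with hS
  have hSm : Measurable S := measurable_sum hχ n
  have hSbdd : ∀ x, |S x| ≤ n * K := fun x => abs_sum_le hK x
  -- bounded measurable functions are integrable for the (probability) Gibbs measures
  have hint : ∀ (b : T3 → ℝ) [IsProbabilityMeasure (posGibbsMeasure b ε n)] (c : ℝ),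
      Integrable (fun x => Real.exp (c * S x)) (posGibbsMeasure b ε n) := by
    intro b _ c
    refine (integrable_const (Real.exp (|c| * (n * K)))).mono'
      (Real.continuous_exp.measurable.comp (measurable_const.mul hSm)).aestronglyMeasurable
      (Eventually.of_forall fun x => ?_)
    rw [Real.norm_eq_abs, abs_of_pos (Real.exp_pos _), Real.exp_le_exp]
    calc c * S x ≤ |c * S x| := le_abs_self _
      _ = |c| * |S x| := abs_mul c _
      _ ≤ |c| * (n * K) := mul_le_mul_of_nonneg_left (hSbdd x) (abs_nonneg c)
  have hSint : Integrable S (posGibbsMeasure at_ ε n) :=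
    (integrable_const ((n : ℝ) * K)).mono' hSm.aestronglyMeasurable
      (Eventually.of_forall fun x => by rw [Real.norm_eq_abs]; exact hSbdd x)
  -- Markov
  have hmarkov := measure_ge_le_exp_mul_mgf (μ := posGibbsMeasure a ε n) (X := S) s ht (hint a t)
  -- the moment generating function is the ratio of partition functions
  have hmgf : mgf S (posGibbsMeasure a ε n) t = (posPartition a ε n)⁻¹ * posPartition at_ ε n :=
    integral_exp_mul_sum_posGibbsMeasure ha ha0' χ t ε n
  -- Jensen under the tilted measure
  have hjensen : Real.exp (∫ x, -(t * S x) ∂posGibbsMeasure at_ ε n) ≤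
      ∫ x, Real.exp (-(t * S x)) ∂posGibbsMeasure at_ ε n := by
    have h := ConvexOn.map_integral_le (μ := posGibbsMeasure at_ ε n) (s := Set.univ)
      (f := fun x => -(t * S x)) (g := Real.exp) convexOn_exp Real.continuous_exp.continuousOn
      isClosed_univ (Eventually.of_forall fun _ => Set.mem_univ _) ((hSint.const_mul t).neg) ?_
    · exact h
    · have := hint at_ (-t)
      refine this.congr (Eventually.of_forall fun x => ?_)
      simp only [Function.comp_apply, neg_mul]
  have hratio : ∫ x, Real.exp (-(t * S x)) ∂posGibbsMeasure at_ ε n =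
      (posPartition at_ ε n)⁻¹ * posPartition a ε n :=
    integral_exp_neg_mul_sum_posGibbsMeasure_tilt ha ha0' hχ t ε n
  -- so `Z(a_t)/Z(a) ≤ exp(t m_t)`
  set m : ℝ := ∫ x, S x ∂posGibbsMeasure at_ ε n with hm
  have hkey : (posPartition a ε n)⁻¹ * posPartition at_ ε n ≤ Real.exp (t * m) := by
    rw [integral_neg, integral_const_mul, hratio] at hjensen
    -- hjensen : exp(-(t m)) ≤ Z(a_t)⁻¹ Z(a)
    have h1 : 0 < (posPartition at_ ε n)⁻¹ * posPartition a ε n := mul_pos (inv_pos.2 hZt) hZ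
    have h2 : (posPartition a ε n)⁻¹ * posPartition at_ ε n =
        ((posPartition at_ ε n)⁻¹ * posPartition a ε n)⁻¹ := by
      rw [mul_inv, inv_inv, mul_comm]
    rw [h2]
    have h3 := inv_anti₀ (Real.exp_pos _) hjensen
    rwa [Real.exp_neg, inv_inv] at h3
  -- assemble
  have hreal : (posGibbsMeasure a ε n).real {x | s ≤ S x} ≤ Real.exp (t * (m - s)) := by
    refine hmarkov.trans ?_
    rw [hmgf]
    calc Real.exp (-t * s) * ((posPartition a ε n)⁻¹ * posPartition at_ ε n)
        ≤ Real.exp (-t * s) * Real.exp (t * m) :=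
          mul_le_mul_of_nonneg_left hkey (Real.exp_pos _).le
      _ = Real.exp (t * (m - s)) := by rw [← Real.exp_add]; ring_nf
  rw [← ofReal_measureReal]
  exact ENNReal.ofReal_le_ofReal hreal

/-- **Exponential concentration of the density field from the tilted mean densities.** For
continuous `a > 0`, continuous `χ`, `0 ≤ σ ≤ 1/2`, a level `I` and `δ > 0`: if for some `t > 0`
and all `N ≥ N₀` the mean of `(N+1)⁻¹ ∑ χ(xᵢ)` under the activity `a e^{tχ}` is `≤ I + δ/2` and
under `a e^{-tχ}` is `≥ I - δ/2`, then there is `C > 0` with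
`μ_a {δ < |(N+1)⁻¹ ∑ χ(xᵢ) - I|} ≤ C e^{-(N+1)/C}` for all `N`. [folklore] -/
theorem posGibbsMeasure_density_concentration (ha : Continuous a) (ha0 : ∀ y, 0 < a y)
    (hχ : Continuous χ) {σ : ℝ} (hσ2 : σ ≤ 1 / 2) {I δ t : ℝ} (hδ : 0 < δ) (ht : 0 < t)
    {N₀ : ℕ}
    (hup : ∀ N : ℕ, N₀ ≤ N → ((N + 1 : ℕ) : ℝ)⁻¹ * ∫ x, ∑ i, χ (x i)
      ∂posGibbsMeasure (fun y => a y * Real.exp (t * χ y)) (hsDiameter σ N) (N + 1) ≤ I + δ / 2)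
    (hdown : ∀ N : ℕ, N₀ ≤ N → I - δ / 2 ≤ ((N + 1 : ℕ) : ℝ)⁻¹ * ∫ x, ∑ i, χ (x i)
      ∂posGibbsMeasure (fun y => a y * Real.exp (-t * χ y)) (hsDiameter σ N) (N + 1)) :
    ∃ C : ℝ, 0 < C ∧ ∀ N : ℕ, posGibbsMeasure a (hsDiameter σ N) (N + 1)
      {x | δ < |((N + 1 : ℕ) : ℝ)⁻¹ * ∑ i, χ (x i) - I|} ≤
        ENNReal.ofReal (C * Real.exp (-(C⁻¹ * (N + 1)))) := by
  have hprob : ∀ N, IsProbabilityMeasure (posGibbsMeasure a (hsDiameter σ N) (N + 1)) :=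
    fun N => isProbabilityMeasure_posGibbsMeasure ha ha0 hσ2 N
  refine exists_const_exp_bound (fun N => prob_le_one) (A := 2) (κ := t * δ / 2) (by positivity)
    (N₀ := N₀) fun N hN => ?_
  set n : ℕ := N + 1 with hn
  have hnpos : (0 : ℝ) < n := by positivity
  -- upper deviations
  have h1 : posGibbsMeasure a (hsDiameter σ N) n {x | (n : ℝ) * (I + δ) ≤ ∑ i, χ (x i)} ≤
      ENNReal.ofReal (Real.exp (-(t * δ / 2) * (N + 1))) := by
    refine (posGibbsMeasure_sum_ge_le_exp ha ha0 hχ hσ2 N ht.le _).trans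
      (ENNReal.ofReal_le_ofReal (Real.exp_le_exp.2 ?_))
    have hup' := hup N hN
    rw [inv_mul_le_iff₀ hnpos] at hup'
    have : t * ((∫ x, ∑ i, χ (x i) ∂posGibbsMeasure (fun y => a y * Real.exp (t * χ y))
        (hsDiameter σ N) n) - n * (I + δ)) ≤ t * (n * (I + δ / 2) - n * (I + δ)) :=
      mul_le_mul_of_nonneg_left (by linarith) ht.le
    refine this.trans (le_of_eq ?_)
    rw [hn]; push_cast; ring
  -- lower deviations, via `-χ`
  have h2 : posGibbsMeasure a (hsDiameter σ N) n {x | (n : ℝ) * (δ - I) ≤ ∑ i, (-χ (x i))} ≤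
      ENNReal.ofReal (Real.exp (-(t * δ / 2) * (N + 1))) := by
    have hχ' : Continuous fun y => -χ y := hχ.neg
    refine (posGibbsMeasure_sum_ge_le_exp ha ha0 hχ' hσ2 N ht.le _).trans
      (ENNReal.ofReal_le_ofReal (Real.exp_le_exp.2 ?_))
    have hdown' := hdown N hN
    rw [le_inv_mul_iff₀ hnpos] at hdown'
    have htilt : (fun y => a y * Real.exp (t * -χ y)) = fun y => a y * Real.exp (-t * χ y) := by
      funext y; ring_nf
    rw [htilt]
    simp only [Finset.sum_neg_distrib, integral_neg]
    have : t * (-(∫ x, ∑ i, χ (x i) ∂posGibbsMeasure (fun y => a y * Real.exp (-t * χ y))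
        (hsDiameter σ N) n) - n * (δ - I)) ≤ t * (-(n * (I - δ / 2)) - n * (δ - I)) :=
      mul_le_mul_of_nonneg_left (by linarith) ht.le
    refine this.trans (le_of_eq ?_)
    rw [hn]; push_cast; ring
  -- the deviation event is contained in the union
  have hsub : {x : Fin n → T3 | δ < |(n : ℝ)⁻¹ * ∑ i, χ (x i) - I|} ⊆
      {x | (n : ℝ) * (I + δ) ≤ ∑ i, χ (x i)} ∪ {x | (n : ℝ) * (δ - I) ≤ ∑ i, (-χ (x i))} := by
    intro x hx
    simp only [mem_setOf_eq, mem_union] at hx ⊢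
    have hx' := hx.le
    rcases le_abs.1 hx' with h | h
    · left
      have : I + δ ≤ (n : ℝ)⁻¹ * ∑ i, χ (x i) := by linarith
      rwa [le_inv_mul_iff₀ hnpos] at this
    · right
      rw [Finset.sum_neg_distrib]
      have : δ - I ≤ -((n : ℝ)⁻¹ * ∑ i, χ (x i)) := by linarith
      rw [← mul_neg] at this
      rwa [le_inv_mul_iff₀ hnpos] at this
  calc posGibbsMeasure a (hsDiameter σ N) n {x | δ < |(n : ℝ)⁻¹ * ∑ i, χ (x i) - I|}
      ≤ posGibbsMeasure a (hsDiameter σ N) n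
          ({x | (n : ℝ) * (I + δ) ≤ ∑ i, χ (x i)} ∪ {x | (n : ℝ) * (δ - I) ≤ ∑ i, (-χ (x i))}) :=
        measure_mono hsub
    _ ≤ _ := measure_union_le _ _
    _ ≤ ENNReal.ofReal (Real.exp (-(t * δ / 2) * (N + 1))) +
        ENNReal.ofReal (Real.exp (-(t * δ / 2) * (N + 1))) := add_le_add h1 h2
    _ = ENNReal.ofReal (2 * Real.exp (-(t * δ / 2) * (N + 1))) := by
        rw [← ENNReal.ofReal_add (Real.exp_pos _).le (Real.exp_pos _).le, two_mul]

end PosGibbs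

end LocalGibbsConcentration

end Summit.AtomisticToContinuum.HydrodynamicLimit.Theorems
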